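import Mathlib
import HarnessLib
import Summits.Ventures.LatticeQCDFlow.Exactness.OpenBoundaryTranslation
import Summits.Ventures.LatticeQCDFlow.Exactness.AxisPermutationSymmetry

/-!
# `⟨P_x⟩ = 0` at every site, and every slab charge has a symmetric law, under the open-boundary Gibbs law — for every placement of the open direction

HONEST FRAMING: exact (Metropolis-corrected) sampling algorithms for lattice gauge theory;
figures of merit are autocorrelation/cost numbers at stated couplings and volumes; no
continuum-physics claim.

Venture `LatticeQCDFlow` (cell pub-lqcd), topic `Exactness`, FANOUT row 21 (`su3-base`, arm `OBC-HMC`).  NEW WORK of the cell,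
def-free, assembling row 21's `OpenBoundaryTranslation` (open direction `τ ≠ 0`: `⟨P_x⟩_OBC = 0` at every site by the site
reflection of direction `0` and a translation; spatial translation invariance `obcGibbs_integral_comp_configTranslate`;
`integrable_cloverPseudoscalar_obcGibbs`) and `AxisPermutationSymmetry` (the open-boundary Gibbs law is invariant under
every axis permutation fixing the open direction, in the Literature's `configPerm` form; the bare clover charge density flips
sign under the transposition `1 ↔ 2`, `cloverPseudoscalar_configPerm_swap`).  Nothing is cited as a fact; no number.

* **`obcGibbs_cloverPseudoscalar_integral_eq_zero_of_dir_zero`** — open direction `0`, compact `G`, continuous unitary `ρ`,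
  every real `β`, `L ≥ 1`: `⟨P_x⟩_OBC = 0` AT EVERY SITE (the transposition `1 ↔ 2` fixes the open direction and the time
  slice of `x` and flips `P`; a translation orthogonal to the open direction brings `s x` back to `x`);
  `obcGibbs_sum_cloverPseudoscalar_integral_eq_zero_of_dir_zero` — `⟨Σ_{x ∈ S} P_x⟩_OBC = 0` for every finite `S`;
* **`obcGibbs_cloverPseudoscalar_integral_eq_zero_all`** — EVERY open direction `τ : Fin 4`, every site;
  `obcGibbs_su_cloverPseudoscalar_integral_eq_zero_all` — the `SU(N)` instance (row 21: `N = 3`).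
* §5 LAWS, not only means (second-countable `G`): `sum_cloverPseudoscalar_configPerm_swap` / `_negReflect_of_symm`
  (`Q_S` is odd under `configPerm s`, resp. `Θ'`, for `S` mapped into itself by `s = sitePerm (swap 1 2)`, resp. `θ'`);
  **`obcGibbs_map_cloverCharge_neg_invariant_of_dir_zero`** / **`_of_ne_zero`** — the law of `Q_S` is symmetric about
  `0`; odd moments vanish; and since every set of slices `{x : x_τ ∈ W}` is symmetric under the relevant involution
  (`sitePerm_swap_mem_slices`, `negReflect_mem_slices`): **`obcGibbs_map_slabCharge_neg_invariant`** — FOR EVERY OPEN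
  DIRECTION `τ` AND EVERY SET OF SLICES `W`, THE SUB-VOLUME CHARGE `Q_W = Σ_{x_τ ∈ W} P_x` HAS A SYMMETRIC LAW under the
  open-boundary Gibbs law (the slab charges of open-boundary practice), `obcGibbs_slabCharge_pow_odd_eq_zero`, and the
  `SU(N)` instance `obcGibbs_su_map_slabCharge_neg_invariant`.

So with open boundaries, as on the torus, a measured `⟨P_x⟩ ≠ 0` at ANY site (boundary slices included) beyond errors
indicts the sampler or the estimator, never the target; so does an asymmetric histogram of any slab charge.
NOT CLAIMED: anything after flow / cooling; `⟨P_x P_y⟩`; the even moments; numbers.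
-/

noncomputable section

namespace Summit.Ventures.LatticeQCDFlow.Exactness

open MeasureTheory Set Function
open Literature.MathematicalPhysics.QuantumFieldTheory
open Literature.MathematicalPhysics.QuantumLattice (cloverPseudoscalar measurable_cloverPseudoscalar fundamentalRep
  continuous_fundamentalRep fundamentalRep_mem_unitaryGroup)
open scoped ENNReal

/-! ## §4 `⟨P_x⟩_OBC = 0` at every site for the open direction `0` -/

section Zero

variable {L N : ℕ} [NeZero L] {G : Type*} [Group G] [TopologicalSpace G] [IsTopologicalGroup G] [CompactSpace G]
  [MeasurableSpace G] [BorelSpace G] (ρ : G →* Matrix (Fin N) (Fin N) ℂ)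

/-- **`⟨P_x⟩_OBC = 0` AT EVERY SITE for the open direction `0`** (compact `G`, continuous unitary `ρ`, every `β`,
`L ≥ 1`): the transposition `1 ↔ 2` fixes the open direction, preserves the open-boundary Gibbs law and flips the sign of
`P`, moving `x` to `s x` in the same time slice; a translation orthogonal to the open direction moves it back. -/
theorem obcGibbs_cloverPseudoscalar_integral_eq_zero_of_dir_zero (hρ : Continuous ρ)
    (hρu : ∀ g, ρ g ∈ Matrix.unitaryGroup (Fin N) ℂ) (β : ℝ) (x : Site 4 L) :
    ∫ U, cloverPseudoscalar ρ x U ∂(gibbsProbability (Measure.pi fun _ : Edge 4 L => haarProbability G)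
      (fun U => Real.exp (-(β * obcAction ρ 0 U)))) = 0 := by
  have h0 : Equiv.swap (1 : Fin 4) 2 0 = 0 := Equiv.swap_apply_of_ne_of_ne (by decide) (by decide)
  -- invariance under the transposition, then the sign flip
  have hE := obcGibbs_integral_comp_configPerm (Equiv.swap (1 : Fin 4) 2) ρ hρ h0 β
    (fun U : GaugeConfig 4 L G => cloverPseudoscalar ρ x U)
  simp only [cloverPseudoscalar_configPerm_swap ρ hρu, integral_neg] at hE
  -- the translation bringing `s x` back to `x`
  set v : Site 4 L := sitePerm (Equiv.swap (1 : Fin 4) 2) x - x with hv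
  have hv0 : v 0 = 0 := by
    rw [hv, Pi.sub_apply, sitePerm_apply, show (Equiv.swap (1 : Fin 4) 2).symm 0 = 0 from by
      rw [Equiv.symm_apply_eq]; exact h0.symm, sub_self]
  have hT := obcGibbs_integral_comp_configTranslate ρ hv0 β (fun U : GaugeConfig 4 L G => cloverPseudoscalar ρ x U)
  simp only [cloverPseudoscalar_configTranslate, hv, sub_add_cancel] at hT
  rw [hT] at hE
  linarith

/-- **`⟨Σ_{x ∈ S} P_x⟩_OBC = 0` for every finite set of sites, open direction `0`** (second-countable `G`). -/
theorem obcGibbs_sum_cloverPseudoscalar_integral_eq_zero_of_dir_zero [SecondCountableTopology G] (hρ : Continuous ρ)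
    (hρu : ∀ g, ρ g ∈ Matrix.unitaryGroup (Fin N) ℂ) (β : ℝ) (S : Finset (Site 4 L)) :
    ∫ U, ∑ x ∈ S, cloverPseudoscalar ρ x U ∂(gibbsProbability (Measure.pi fun _ : Edge 4 L => haarProbability G)
      (fun U => Real.exp (-(β * obcAction ρ 0 U)))) = 0 := by
  rw [integral_finsetSum S fun x _ => integrable_cloverPseudoscalar_obcGibbs ρ hρ 0 β x]
  exact Finset.sum_eq_zero fun x _ => obcGibbs_cloverPseudoscalar_integral_eq_zero_of_dir_zero ρ hρ hρu β x

/-- **EVERY PLACEMENT OF THE OPEN DIRECTION**: `⟨P_x⟩_OBC = 0` at every site for every open direction `τ : Fin 4`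
(`τ = 0` here, `τ ≠ 0` by `OpenBoundaryTranslation.obcGibbs_cloverPseudoscalar_integral_eq_zero`). -/
theorem obcGibbs_cloverPseudoscalar_integral_eq_zero_all (hρ : Continuous ρ)
    (hρu : ∀ g, ρ g ∈ Matrix.unitaryGroup (Fin N) ℂ) (τ : Fin 4) (β : ℝ) (x : Site 4 L) :
    ∫ U, cloverPseudoscalar ρ x U ∂(gibbsProbability (Measure.pi fun _ : Edge 4 L => haarProbability G)
      (fun U => Real.exp (-(β * obcAction ρ τ U)))) = 0 := by
  by_cases hτ : τ = 0
  · subst hτ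
    exact obcGibbs_cloverPseudoscalar_integral_eq_zero_of_dir_zero ρ hρ hρu β x
  · exact obcGibbs_cloverPseudoscalar_integral_eq_zero ρ hρ hρu hτ β x

/-- **The `SU(N)` instance** (row 21: `N = 3`): `⟨P_x⟩_OBC = 0` at every site, every open direction, every real `β`,
every `L ≥ 1`. -/
theorem obcGibbs_su_cloverPseudoscalar_integral_eq_zero_all (n : ℕ) (τ : Fin 4) (β : ℝ) (x : Site 4 L) :
    ∫ U, cloverPseudoscalar (fundamentalRep (Fin n)) x U ∂(gibbsProbability
      (Measure.pi fun _ : Edge 4 L => haarProbability (Matrix.specialUnitaryGroup (Fin n) ℂ))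
      (fun U => Real.exp (-(β * obcAction (fundamentalRep (Fin n)) τ U)))) = 0 :=
  obcGibbs_cloverPseudoscalar_integral_eq_zero_all (fundamentalRep (Fin n)) (continuous_fundamentalRep (Fin n))
    fundamentalRep_mem_unitaryGroup τ β x

end Zero

/-! ## §5 The charge of a symmetric set of sites — in particular of any set of slices — has a symmetric law, for every placement of the open direction -/

section Law

variable {L N : ℕ} [NeZero L] {G : Type*} [Group G] [TopologicalSpace G] [IsTopologicalGroup G] [CompactSpace G]
  [MeasurableSpace G] [BorelSpace G] (ρ : G →* Matrix (Fin N) (Fin N) ℂ)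

omit [NeZero L] in
/-- Reindexing a site sum over a set mapped into itself by an involution. -/
theorem sum_comp_eq_of_involutive {σ : Site 4 L → Site 4 L} (hσ : Function.Involutive σ) {S : Finset (Site 4 L)}
    (hS : ∀ x ∈ S, σ x ∈ S) (f : Site 4 L → ℝ) : ∑ x ∈ S, f (σ x) = ∑ x ∈ S, f x := by
  refine Finset.sum_equiv hσ.toPerm (fun x => ?_) (fun x _ => ?_)
  · simp only [Function.Involutive.coe_toPerm]
    refine ⟨hS x, fun hx => ?_⟩
    have h := hS _ hx
    rwa [hσ x] at h
  · simp only [Function.Involutive.coe_toPerm]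

omit [NeZero L] in
/-- The site transposition `s = sitePerm (swap 1 2)` is an involution. -/
theorem sitePerm_swap_involutive : Function.Involutive (sitePerm (L := L) (Equiv.swap (1 : Fin 4) 2)) := fun x => by
  funext k
  simp only [sitePerm_apply, Equiv.symm_swap, Equiv.swap_apply_self]

omit [NeZero L] [TopologicalSpace G] [IsTopologicalGroup G] [CompactSpace G] [BorelSpace G] in
/-- **`Q_S(configPerm s U) = −Q_S(U)`** for every finite set of sites `S` mapped into itself by `s = sitePerm (swap 1 2)`. -/
theorem sum_cloverPseudoscalar_configPerm_swap (hρu : ∀ g, ρ g ∈ Matrix.unitaryGroup (Fin N) ℂ) {S : Finset (Site 4 L)}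
    (hS : ∀ x ∈ S, sitePerm (Equiv.swap (1 : Fin 4) 2) x ∈ S) (U : GaugeConfig 4 L G) :
    ∑ x ∈ S, cloverPseudoscalar ρ x (configPerm (Equiv.swap (1 : Fin 4) 2) U) = -∑ x ∈ S, cloverPseudoscalar ρ x U := by
  rw [Finset.sum_congr rfl fun x _ => cloverPseudoscalar_configPerm_swap ρ hρu U x, Finset.sum_neg_distrib,
    sum_comp_eq_of_involutive sitePerm_swap_involutive hS fun x => cloverPseudoscalar ρ x U]

omit [NeZero L] [TopologicalSpace G] [IsTopologicalGroup G] [CompactSpace G] [MeasurableSpace G] [BorelSpace G] in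
/-- **`Q_S(Θ'U) = −Q_S(U)`** for every finite set of sites `S` mapped into itself by the site reflection `θ'` of direction `0`. -/
theorem sum_cloverPseudoscalar_negReflect_of_symm (hρu : ∀ g, ρ g ∈ Matrix.unitaryGroup (Fin N) ℂ)
    {S : Finset (Site 4 L)} (hS : ∀ x ∈ S, x.negReflect ∈ S) (U : GaugeConfig 4 L G) :
    ∑ x ∈ S, cloverPseudoscalar ρ x U.negReflect = -∑ x ∈ S, cloverPseudoscalar ρ x U := by
  rw [Finset.sum_congr rfl fun x _ => Scoring.cloverPseudoscalar_negReflect ρ hρu x U, Finset.sum_neg_distrib,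
    sum_comp_eq_of_involutive (WilsonSiteRP.negReflect_negReflect (d := 4) (L := L)) hS fun x => cloverPseudoscalar ρ x U]

variable [SecondCountableTopology G]

/-- **THE LAW OF `Q_S` IS SYMMETRIC ABOUT `0`, open direction `0`**, for every finite `S` with `s S ⊆ S`
(compact second-countable `G`, continuous unitary `ρ`, every real `β`, `L ≥ 1`). -/
theorem obcGibbs_map_cloverCharge_neg_invariant_of_dir_zero (hρ : Continuous ρ)
    (hρu : ∀ g, ρ g ∈ Matrix.unitaryGroup (Fin N) ℂ) (β : ℝ) {S : Finset (Site 4 L)}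
    (hS : ∀ x ∈ S, sitePerm (Equiv.swap (1 : Fin 4) 2) x ∈ S) :
    ((gibbsProbability (Measure.pi fun _ : Edge 4 L => haarProbability G)
        (fun U => Real.exp (-(β * obcAction ρ 0 U)))).map (fun U => ∑ x ∈ S, cloverPseudoscalar ρ x U)).map Neg.neg =
      (gibbsProbability (Measure.pi fun _ : Edge 4 L => haarProbability G)
        (fun U => Real.exp (-(β * obcAction ρ 0 U)))).map (fun U => ∑ x ∈ S, cloverPseudoscalar ρ x U) :=
  Scoring.map_neg_map_of_odd _ (measurePreserving_configPerm_obcGibbs (Equiv.swap (1 : Fin 4) 2) ρ hρ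
      (Equiv.swap_apply_of_ne_of_ne (by decide) (by decide)) β)
    (Finset.measurable_sum S fun x _ => measurable_cloverPseudoscalar ρ hρ x).aemeasurable
    (sum_cloverPseudoscalar_configPerm_swap ρ hρu hS)

/-- **THE LAW OF `Q_S` IS SYMMETRIC ABOUT `0`, open direction `τ ≠ 0`**, for every finite `S` with `θ' S ⊆ S`. -/
theorem obcGibbs_map_cloverCharge_neg_invariant_of_ne_zero {τ : Fin 4} (hρ : Continuous ρ)
    (hρu : ∀ g, ρ g ∈ Matrix.unitaryGroup (Fin N) ℂ) (hτ : τ ≠ 0) (β : ℝ) {S : Finset (Site 4 L)}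
    (hS : ∀ x ∈ S, x.negReflect ∈ S) :
    ((gibbsProbability (Measure.pi fun _ : Edge 4 L => haarProbability G)
        (fun U => Real.exp (-(β * obcAction ρ τ U)))).map (fun U => ∑ x ∈ S, cloverPseudoscalar ρ x U)).map Neg.neg =
      (gibbsProbability (Measure.pi fun _ : Edge 4 L => haarProbability G)
        (fun U => Real.exp (-(β * obcAction ρ τ U)))).map (fun U => ∑ x ∈ S, cloverPseudoscalar ρ x U) :=
  Scoring.map_neg_map_of_odd _ (measurePreserving_negReflect_obcGibbs ρ hρ hτ β)
    (Finset.measurable_sum S fun x _ => measurable_cloverPseudoscalar ρ hρ x).aemeasurable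
    (sum_cloverPseudoscalar_negReflect_of_symm ρ hρu hS)

omit [SecondCountableTopology G] in
/-- **Odd moments vanish, open direction `0`**: `⟨Q_S^{2k+1}⟩_OBC = 0` for every `s`-symmetric `S`. -/
theorem obcGibbs_cloverCharge_pow_odd_eq_zero_of_dir_zero (hρ : Continuous ρ)
    (hρu : ∀ g, ρ g ∈ Matrix.unitaryGroup (Fin N) ℂ) (β : ℝ) {S : Finset (Site 4 L)}
    (hS : ∀ x ∈ S, sitePerm (Equiv.swap (1 : Fin 4) 2) x ∈ S) (k : ℕ) :
    ∫ U, (∑ x ∈ S, cloverPseudoscalar ρ x U) ^ (2 * k + 1) ∂(gibbsProbability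
      (Measure.pi fun _ : Edge 4 L => haarProbability G) (fun U => Real.exp (-(β * obcAction ρ 0 U)))) = 0 :=
  Scoring.integral_pow_odd_eq_zero_of_odd _ (measurePreserving_configPerm_obcGibbs (Equiv.swap (1 : Fin 4) 2) ρ hρ
      (Equiv.swap_apply_of_ne_of_ne (by decide) (by decide)) β) (sum_cloverPseudoscalar_configPerm_swap ρ hρu hS) k

omit [SecondCountableTopology G] in
/-- **Odd moments vanish, open direction `τ ≠ 0`**: `⟨Q_S^{2k+1}⟩_OBC = 0` for every `θ'`-symmetric `S`. -/
theorem obcGibbs_cloverCharge_pow_odd_eq_zero_of_ne_zero {τ : Fin 4} (hρ : Continuous ρ)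
    (hρu : ∀ g, ρ g ∈ Matrix.unitaryGroup (Fin N) ℂ) (hτ : τ ≠ 0) (β : ℝ) {S : Finset (Site 4 L)}
    (hS : ∀ x ∈ S, x.negReflect ∈ S) (k : ℕ) :
    ∫ U, (∑ x ∈ S, cloverPseudoscalar ρ x U) ^ (2 * k + 1) ∂(gibbsProbability
      (Measure.pi fun _ : Edge 4 L => haarProbability G) (fun U => Real.exp (-(β * obcAction ρ τ U)))) = 0 :=
  Scoring.integral_pow_odd_eq_zero_of_odd _ (measurePreserving_negReflect_obcGibbs ρ hρ hτ β)
    (sum_cloverPseudoscalar_negReflect_of_symm ρ hρu hS) k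

omit [Group G] [TopologicalSpace G] [IsTopologicalGroup G] [CompactSpace G] [MeasurableSpace G] [BorelSpace G]
  [SecondCountableTopology G] in
/-- A set of slices of the open direction `0` is `s`-symmetric (`s` does not move the coordinate `0`). -/
theorem sitePerm_swap_mem_slices (W : Finset (ZMod L)) (x : Site 4 L)
    (hx : x ∈ Finset.univ.filter fun y : Site 4 L => y 0 ∈ W) :
    sitePerm (Equiv.swap (1 : Fin 4) 2) x ∈ Finset.univ.filter fun y : Site 4 L => y 0 ∈ W := by
  simp only [Finset.mem_filter, Finset.mem_univ, true_and, sitePerm_apply, Equiv.symm_swap] at hx ⊢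
  rwa [Equiv.swap_apply_of_ne_of_ne (by decide) (by decide)]

omit [Group G] [TopologicalSpace G] [IsTopologicalGroup G] [CompactSpace G] [MeasurableSpace G] [BorelSpace G]
  [SecondCountableTopology G] in
/-- A set of slices of an open direction `τ ≠ 0` is `θ'`-symmetric (`θ'` only moves the coordinate `0`). -/
theorem negReflect_mem_slices {τ : Fin 4} (hτ : τ ≠ 0) (W : Finset (ZMod L)) (x : Site 4 L)
    (hx : x ∈ Finset.univ.filter fun y : Site 4 L => y τ ∈ W) :
    x.negReflect ∈ Finset.univ.filter fun y : Site 4 L => y τ ∈ W := by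
  simp only [Finset.mem_filter, Finset.mem_univ, true_and] at hx ⊢
  rwa [WilsonSiteRP.negReflect_apply_of_ne x hτ]

/-- **THE SLAB CHARGE HAS A SYMMETRIC LAW FOR EVERY PLACEMENT OF THE OPEN DIRECTION**: for every open direction
`τ : Fin 4`, every set `W` of slices `x_τ ∈ W` (the sub-volume charges of open-boundary practice, boundary slices
allowed or not) and every real `β`, the law of `Q_W = Σ_{x : x_τ ∈ W} P_x` under the open-boundary Gibbs law is
symmetric about `0`. -/
theorem obcGibbs_map_slabCharge_neg_invariant (hρ : Continuous ρ) (hρu : ∀ g, ρ g ∈ Matrix.unitaryGroup (Fin N) ℂ)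
    (τ : Fin 4) (W : Finset (ZMod L)) (β : ℝ) :
    ((gibbsProbability (Measure.pi fun _ : Edge 4 L => haarProbability G)
        (fun U => Real.exp (-(β * obcAction ρ τ U)))).map
        (fun U => ∑ x ∈ Finset.univ.filter (fun y : Site 4 L => y τ ∈ W), cloverPseudoscalar ρ x U)).map Neg.neg =
      (gibbsProbability (Measure.pi fun _ : Edge 4 L => haarProbability G)
        (fun U => Real.exp (-(β * obcAction ρ τ U)))).map
        (fun U => ∑ x ∈ Finset.univ.filter (fun y : Site 4 L => y τ ∈ W), cloverPseudoscalar ρ x U) := by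
  by_cases hτ : τ = 0
  · subst hτ
    exact obcGibbs_map_cloverCharge_neg_invariant_of_dir_zero ρ hρ hρu β (sitePerm_swap_mem_slices W)
  · exact obcGibbs_map_cloverCharge_neg_invariant_of_ne_zero ρ hρ hρu hτ β (negReflect_mem_slices hτ W)

omit [SecondCountableTopology G] in
/-- **Odd moments of every slab charge vanish**, every open direction: `⟨Q_W^{2k+1}⟩_OBC = 0`. -/
theorem obcGibbs_slabCharge_pow_odd_eq_zero (hρ : Continuous ρ) (hρu : ∀ g, ρ g ∈ Matrix.unitaryGroup (Fin N) ℂ)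
    (τ : Fin 4) (W : Finset (ZMod L)) (β : ℝ) (k : ℕ) :
    ∫ U, (∑ x ∈ Finset.univ.filter (fun y : Site 4 L => y τ ∈ W), cloverPseudoscalar ρ x U) ^ (2 * k + 1)
      ∂(gibbsProbability (Measure.pi fun _ : Edge 4 L => haarProbability G)
        (fun U => Real.exp (-(β * obcAction ρ τ U)))) = 0 := by
  by_cases hτ : τ = 0
  · subst hτ
    exact obcGibbs_cloverCharge_pow_odd_eq_zero_of_dir_zero ρ hρ hρu β (sitePerm_swap_mem_slices W) k
  · exact obcGibbs_cloverCharge_pow_odd_eq_zero_of_ne_zero ρ hρ hρu hτ β (negReflect_mem_slices hτ W) k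

/-- **The `SU(N)` instance** (row 21: `N = 3`): every slab charge of the open lattice has a symmetric law, every open
direction, every real `β`, every `L ≥ 1`. -/
theorem obcGibbs_su_map_slabCharge_neg_invariant (n : ℕ) (τ : Fin 4) (W : Finset (ZMod L)) (β : ℝ) :
    ((gibbsProbability (Measure.pi fun _ : Edge 4 L => haarProbability (Matrix.specialUnitaryGroup (Fin n) ℂ))
        (fun U => Real.exp (-(β * obcAction (fundamentalRep (Fin n)) τ U)))).map
        (fun U => ∑ x ∈ Finset.univ.filter (fun y : Site 4 L => y τ ∈ W),
          cloverPseudoscalar (fundamentalRep (Fin n)) x U)).map Neg.neg =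
      (gibbsProbability (Measure.pi fun _ : Edge 4 L => haarProbability (Matrix.specialUnitaryGroup (Fin n) ℂ))
        (fun U => Real.exp (-(β * obcAction (fundamentalRep (Fin n)) τ U)))).map
        (fun U => ∑ x ∈ Finset.univ.filter (fun y : Site 4 L => y τ ∈ W),
          cloverPseudoscalar (fundamentalRep (Fin n)) x U) :=
  obcGibbs_map_slabCharge_neg_invariant (fundamentalRep (Fin n)) (continuous_fundamentalRep (Fin n))
    fundamentalRep_mem_unitaryGroup τ W β

end Law

end Summit.Ventures.LatticeQCDFlow.Exactness
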